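import Literature.Geometry.Lorentzian.KerrDataSecondFundamentalFormFine
import Literature.Geometry.Lorentzian.KerrDataSchwarzschildExtrinsic
import HarnessLib

/-!
# Kerr–Schild slices of Kerr are not strongly asymptotically flat in the sense of Dafermos–Rodnianski (discharge of `Kerr.not_isStronglyAsymptoticallyFlatDR_data`)

Discharge of the named fact `Kerr.not_isStronglyAsymptoticallyFlatDR_data` (`KerrData.lean`): for
`M > 0` and every spin `a`, slice parameter `r₀` and mass parameter `M'`, the Kerr data on the
slice `{t* = 0}` of the Kerr–Schild chart are **not** strongly asymptotically flat on the end
`Kerr.afEnd a r₀` in the sense of Dafermos–Rodnianski, App. B.2.3 (`k = o₁(r⁻²)`): the second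
fundamental form of a Kerr–Schild slice decays exactly like `r⁻²`, not faster. Cook, Living Rev.
Relativ. 3 (2000) 5, §3.2.2, (57)–(58) (`K_ij = −(2Mα/r²)(δ_ij − (2 + M/r) nᵢnⱼ)` for
Schwarzschild, `tr K = (2M/r²)(1 + 3M/r) α³`); García-Parrado–Valiente Kroon, J. Geom. Phys. 58
(2008), §5 (the spin corrections are `O(r⁻³)`); Dafermos–Rodnianski, arXiv:0811.0354, App. B.2.3.

## Proof

Suppose the data were DR-strongly asymptotically flat. The `m = 0` case of the `k`-decay says
`‖k_a(z)‖ = o(‖z‖⁻²)` for the chart components `k_a = AFEnd.kCoeff (afEnd a r₀) (data M a r₀)`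
(`norm_iteratedFDeriv_zero`). By `Kerr.isBigOSmooth_kCoeff_sub_zero`
(`KerrDataSecondFundamentalFormFine.lean`) the components at spin `a` differ from those of the
Schwarzschild Kerr–Schild data by `O(‖z‖⁻³)`, so `‖k_0(z)‖ ≤ (M/4) ‖z‖⁻² + C ‖z‖⁻³` far out. But
the Schwarzschild components are known in closed form (`Kerr.data_k_zero_apply`,
`Kerr.kCoeff_afEnd_data_apply`): radially,
`k_0(z)(z, z) = 2M (1 + M/‖z‖) / √(1 + 2M/‖z‖) ≥ M` once `‖z‖ ≥ 2M` (`Kerr.le_kRep_self`), while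
`|k_0(z)(z, z)| ≤ ‖k_0(z)‖ ‖z‖² ≤ M/4 + C/‖z‖ < M` for `‖z‖ > 4C/(3M)` — a contradiction at any
far point of a ray.

* `Kerr.kRep_self`, `Kerr.le_kRep_self` — the radial value of Cook's closed form and its lower
  bound;
* `Kerr.not_isStronglyAsymptoticallyFlatDR_data_holds` — **the named fact, verbatim**.

Everything is proved; no definitions, no named facts.

## References

* G. B. Cook, *Initial data for numerical relativity*, Living Rev. Relativ. 3 (2000) 5, §3.2.2,
  (57)–(58).
* A. García-Parrado, J. A. Valiente Kroon, *Kerr initial data*, J. Geom. Phys. 58 (2008), §5.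
* M. Dafermos, I. Rodnianski, *Lectures on black holes and linear waves*, arXiv:0811.0354,
  App. B.2.3.
-/

noncomputable section

open Set Filter Asymptotics Bornology Topology
open scoped RealInnerProductSpace

-- iterated operator-norm spaces over `E3` (as in `KerrDataAsymptoticFlatness.lean`)
set_option maxSynthPendingDepth 3

namespace Literature.Geometry.Lorentzian

namespace Kerr

/-- **The radial value of Cook's closed form** for the second fundamental form of the
Schwarzschild Kerr–Schild slice: `k_0(z)(z, z) = 2M (1 + M/r) / √(1 + 2M/r)`, `r = ‖z‖ ≠ 0`
(`K_ij nⁱ nʲ r² = −(2Mα/r²)(1 − (2 + M/r)) r²`). Cook 2000, §3.2.2, (57). [cite: Cook2000, §3.2.2 (57)] -/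
theorem kRep_self (M : ℝ) {z : E3} (hz : z ≠ 0) :
    kRep M z z z = 2 * M * (1 + M / ‖z‖) / √(1 + 2 * M / ‖z‖) := by
  have hr : ‖z‖ ≠ 0 := norm_ne_zero_iff.2 hz
  rw [kRep, real_inner_self_eq_norm_sq]
  field_simp
  ring

/-- **The radial component of `k` of a Schwarzschild Kerr–Schild slice is of exact order `r⁰` in
`k(z, z)`**, i.e. of exact order `r⁻²` on unit vectors: for `M > 0` and `‖z‖ ≥ 2M`,
`k_0(z)(z, z) = 2M(1 + M/r)/√(1 + 2M/r) ≥ M` (as `√(1 + 2M/r) ≤ √2 ≤ 2`). Cook 2000, §3.2.2,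
(57)–(58). [cite: Cook2000, §3.2.2 (57)] -/
theorem le_kRep_self {M : ℝ} (hM : 0 < M) {z : E3} (hz : 2 * M ≤ ‖z‖) : M ≤ kRep M z z z := by
  have hr : 0 < ‖z‖ := lt_of_lt_of_le (by positivity) hz
  rw [kRep_self M (norm_pos_iff.1 hr)]
  have h1 : 0 ≤ M / ‖z‖ := by positivity
  have h2 : 2 * M / ‖z‖ ≤ 1 := by
    rw [div_le_one hr]
    exact hz
  have hs_pos : 0 < √(1 + 2 * M / ‖z‖) := Real.sqrt_pos.2 (by positivity)
  have hs_le : √(1 + 2 * M / ‖z‖) ≤ 2 := by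
    rw [Real.sqrt_le_iff]
    constructor
    · norm_num
    · linarith
  rw [le_div_iff₀ hs_pos]
  nlinarith

/-- **Discharge of the named fact `Kerr.not_isStronglyAsymptoticallyFlatDR_data`**
(`KerrData.lean`), verbatim: for `M > 0` the Kerr data on a Kerr–Schild slice are not
DR-strongly asymptotically flat (`k ≠ o₁(r⁻²)`), whatever the spin `a`, the slice parameter
`r₀` and the mass parameter `M'`. The `m = 0` case of the `k`-decay (`‖k_a‖ = o(r⁻²)`), the
`O(r⁻³)` proximity of the spin-`a` and spin-`0` components (`isBigOSmooth_kCoeff_sub_zero`) and the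
closed form at spin `0` (`data_k_zero_apply`, radially `≥ M`, `le_kRep_self`) are incompatible at
any far point of a ray. Cook 2000, §3.2.2, (57)–(58); García-Parrado–Valiente Kroon 2008, §5;
Dafermos–Rodnianski arXiv:0811.0354, App. B.2.3. [cite: arXiv08110354, App. B.2.3] -/
theorem not_isStronglyAsymptoticallyFlatDR_data_holds :
    ∀ [Facts] [SliceFacts] (M a r₀ : ℝ), not_isStronglyAsymptoticallyFlatDR_data M a r₀ := by
  intro _ _ M a r₀ hM M' hSAF
  -- (1) `‖k_a(z)‖ ≤ (M/4) ‖z‖⁻²` far out (the `m = 0` case of `k = o₁(r⁻²)`)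
  have hk : ∀ᶠ z in cobounded E3,
      ‖AFEnd.kCoeff (afEnd a r₀) (data M a r₀ hM.le) z‖ ≤ M / 4 * ‖z‖ ^ (-2 : ℝ) := by
    have h := (hSAF.2 0 (by norm_num)).def (c := M / 4) (by positivity)
    filter_upwards [h] with z hz
    simpa only [norm_iteratedFDeriv_zero, norm_norm, Nat.cast_zero, sub_zero,
      Real.norm_of_nonneg (Real.rpow_nonneg (norm_nonneg z) _)] using hz
  -- (2) `‖k_a(z) − k_0(z)‖ ≤ C ‖z‖⁻³` far out
  obtain ⟨C, hC, hCw⟩ := ((isBigOSmooth_kCoeff_sub_zero hM.le a r₀ 0).2 0 le_rfl).exists_pos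
  have hD : ∀ᶠ z in cobounded E3,
      ‖AFEnd.kCoeff (afEnd a r₀) (data M a r₀ hM.le) z -
        AFEnd.kCoeff (afEnd 0 r₀) (data M 0 r₀ hM.le) z‖ ≤ C * ‖z‖ ^ (-3 : ℝ) := by
    filter_upwards [hCw.bound] with z hz
    simpa only [norm_iteratedFDeriv_zero, norm_norm, Nat.cast_zero, sub_zero,
      Real.norm_of_nonneg (Real.rpow_nonneg (norm_nonneg z) _)] using hz
  obtain ⟨R₁, hR₁⟩ := exists_radius_of_eventually_cobounded (hk.and hD)
  -- (3) a far point `z = t e₀` on a ray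
  set t : ℝ := max (max R₁ (afRadius 0 r₀)) (max (2 * M) (4 * C / (3 * M))) + 1 with ht
  have htR : R₁ < t :=
    lt_of_le_of_lt ((le_max_left _ _).trans (le_max_left _ _)) (lt_add_one _)
  have ht0r : afRadius 0 r₀ < t :=
    lt_of_le_of_lt ((le_max_right _ _).trans (le_max_left _ _)) (lt_add_one _)
  have ht2M : 2 * M ≤ t :=
    ((le_max_left _ _).trans (le_max_right _ _)).trans (lt_add_one _).le
  have htC : 4 * C / (3 * M) < t :=
    lt_of_le_of_lt ((le_max_right _ _).trans (le_max_right _ _)) (lt_add_one _)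
  have ht0 : 0 < t := lt_of_lt_of_le (by positivity) ht2M
  set z : E3 := t • EuclideanSpace.single (0 : Fin 3) (1 : ℝ) with hzdef
  have he : ‖(EuclideanSpace.single (0 : Fin 3) (1 : ℝ) : E3)‖ = 1 := by simp
  have hz : ‖z‖ = t := by
    rw [hzdef, norm_smul, he, mul_one, Real.norm_of_nonneg ht0.le]
  obtain ⟨hkz, hDz⟩ := hR₁ z (by rw [hz]; exact htR)
  rw [hz] at hkz hDz
  -- (4) the closed form at spin `0`, radially: `k_0(z)(z, z) = kRep M z z z ≥ M`
  have hza : afRadius 0 r₀ < ‖z‖ := by rw [hz]; exact ht0r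
  have h0 : AFEnd.kCoeff (afEnd 0 r₀) (data M 0 r₀ hM.le) z z z = kRep M z z z := by
    rw [kCoeff_afEnd_data_apply hM.le 0 r₀ hza, ← data_k M 0 r₀ hM.le]
    exact data_k_zero_apply M hM.le ⟨z, mem_slice_of_lt_norm hza⟩ z z
  have hlow : M ≤ kRep M z z z := le_kRep_self hM (by rw [hz]; exact ht2M)
  -- (5) the upper bound `|k_0(z)(z, z)| ≤ ‖k_0(z)‖ t² ≤ M/4 + C/t < M`
  have hnorm : ‖AFEnd.kCoeff (afEnd 0 r₀) (data M 0 r₀ hM.le) z‖ ≤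
      M / 4 * t ^ (-2 : ℝ) + C * t ^ (-3 : ℝ) := by
    calc ‖AFEnd.kCoeff (afEnd 0 r₀) (data M 0 r₀ hM.le) z‖
        = ‖AFEnd.kCoeff (afEnd a r₀) (data M a r₀ hM.le) z -
            (AFEnd.kCoeff (afEnd a r₀) (data M a r₀ hM.le) z -
              AFEnd.kCoeff (afEnd 0 r₀) (data M 0 r₀ hM.le) z)‖ := by rw [sub_sub_cancel]
      _ ≤ ‖AFEnd.kCoeff (afEnd a r₀) (data M a r₀ hM.le) z‖ +
            ‖AFEnd.kCoeff (afEnd a r₀) (data M a r₀ hM.le) z -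
              AFEnd.kCoeff (afEnd 0 r₀) (data M 0 r₀ hM.le) z‖ := norm_sub_le _ _
      _ ≤ M / 4 * t ^ (-2 : ℝ) + C * t ^ (-3 : ℝ) := add_le_add hkz hDz
  have happ : |AFEnd.kCoeff (afEnd 0 r₀) (data M 0 r₀ hM.le) z z z| ≤
      ‖AFEnd.kCoeff (afEnd 0 r₀) (data M 0 r₀ hM.le) z‖ * t * t := by
    have h := (AFEnd.kCoeff (afEnd 0 r₀) (data M 0 r₀ hM.le) z).le_opNorm₂ z z
    rwa [Real.norm_eq_abs, hz] at h
  have e2 : t ^ (-2 : ℝ) = (t ^ 2)⁻¹ := by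
    rw [Real.rpow_neg ht0.le, Real.rpow_two]
  have e3 : t ^ (-3 : ℝ) = (t ^ 3)⁻¹ := by
    rw [Real.rpow_neg ht0.le, show (3 : ℝ) = ((3 : ℕ) : ℝ) by norm_num, Real.rpow_natCast]
  have hup : kRep M z z z ≤ M / 4 + C / t := by
    calc kRep M z z z = AFEnd.kCoeff (afEnd 0 r₀) (data M 0 r₀ hM.le) z z z := h0.symm
      _ ≤ |AFEnd.kCoeff (afEnd 0 r₀) (data M 0 r₀ hM.le) z z z| := le_abs_self _
      _ ≤ ‖AFEnd.kCoeff (afEnd 0 r₀) (data M 0 r₀ hM.le) z‖ * t * t := happ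
      _ ≤ (M / 4 * t ^ (-2 : ℝ) + C * t ^ (-3 : ℝ)) * t * t := by gcongr
      _ = M / 4 + C / t := by
        rw [e2, e3]
        field_simp
  have hCt : C / t < 3 * M / 4 := by
    rw [div_lt_iff₀ ht0]
    rw [div_lt_iff₀ (by positivity)] at htC
    linarith
  linarith

end Kerr

end Literature.Geometry.Lorentzian

end
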